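import Summits.AnomalousDissipation.AnomalousDissipation.Theorems.SawtoothPulseCascadeK1LocalisedCascadeIterateGradient
import Literature.Analysis.FunctionSpaces.TorusCoordinateFunctions

/-!
# K1loc, line `Spectral` — S-D (first good piece): THE INVISCID ITERATE READ ON THE PLANE (backward trajectories)

Helper file of the prover lane on the crux `K1LocalisedCascade` (stmt-AnomalousDissipation-19491), route
`SawtoothPulseCascade`, registered line `Cruxes.K1LocalisedCascade.Spectral` (one open stub `stub_highModeConcentration`).
Glue between the torus-side inviscid iterate of `…StartTransfer` (`b j = a j ∘ shearMap 0 1 (γ•U_j)`,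
`a (j+1) = b j ∘ shearMap 1 0 (γ•U_j)`) and the planar bookkeeping of `…AffinePair`: a BACKWARD PLANAR TRAJECTORY is a sequence
`z : ℕ → ℝ²` with `z j = S_{H,j}(S_{V,j}(z (j+1)))`, `S_{V,j} = shearMapLift 1 0 (γ•U_j)`, `S_{H,j} = shearMapLift 0 1 (γ•U_j)` (the planar
lifts of the torus shears, `Torus.shearMap_proj`).  Then

* `iterate_proj_eq` — `a n (proj (z n)) = a 0 (proj (z 0))`, and with `a 0 = datum`: `a n (proj (z n)) = sin(2π (z 0)₀)`
  (`iterate_proj_eq_sin`; `datum ∘ proj = sin(2π y₀)`, `datum_proj`);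
* `shearMapLift_apply_coord` and `trajectory_coords` — the coordinates of the trajectory and of its V-outputs
  `w j = S_{V,j}(z (j+1))` satisfy exactly the componentwise recursion consumed by `…K1Start.norm_sub_sub_itinJac_mulVec_le`:
  `w j 0 = z (j+1) 0`, `w j 1 = z (j+1) 1 − γU_j(z (j+1) 0)`, `z j 0 = w j 0 − γU_j(w j 1)`, `z j 1 = w j 1`.

So the phase of the iterate along a horizontal chord `y + s e₀` is `Φ(s) = (z_s 0)₀` with `z_s n = y + s e₀`, and `…AffinePair` /
`…OscillatoryChord` apply to it.  WHAT THIS IS NOT: no statement about which chords are good (the line count, memo v8 §7).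
[cite: BardosTitiWiedemann2012, Lemma 4 (transport by a shear is composition with the shear map)] [problem: turb]
-/

-- `Summit.<Summit>.<Problem>`: single-conjunct summit, the duplicate namespace segment is deliberate.
set_option linter.dupNamespace false

noncomputable section

namespace Summit.AnomalousDissipation.AnomalousDissipation.Theorems.SawtoothPulseCascade.K1Start

open Set Function UnitAddTorus
open Literature.Analysis Literature.Analysis.FunctionSpaces Literature.Analysis.FunctionSpaces.Torus
open Literature.Analysis.FluidPDE.ShearStage
open Literature.Analysis.FluidPDE.SawtoothCascade Literature.Analysis.FluidPDE.SawtoothCascade.CascadeParams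

/-! ## §1 Coordinates of the planar shear lift -/

/-- Coordinates of the planar shear lift: `(shearMapLift i j φ y)_l = y_l − [l = i] φ(y_j)`. [folklore] -/
theorem shearMapLift_apply_coord (i j : Fin 2) (Q : ShearProfile) (y : EuclideanSpace ℝ (Fin 2)) (l : Fin 2) :
    shearMapLift i j Q y l = y l - if l = i then Q (y j) else 0 := by
  simp only [shearMapLift, PiLp.sub_apply, PiLp.smul_apply, PiLp.single_apply, smul_eq_mul, mul_ite, mul_one,
    mul_zero]

/-- The datum read on the plane: `datum (proj y) = sin(2π y₀)`. [folklore] -/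
theorem datum_proj (y : EuclideanSpace ℝ (Fin 2)) : datum (proj y) = Real.sin (2 * Real.pi * y 0) := by
  have hper : Function.Periodic (fun s : ℝ => Real.sin (2 * Real.pi * s)) 1 := fun s => by
    simp [mul_add, Real.sin_add_two_pi]
  have h := lift_coordFun_apply (d := Fin 2) hper 0 y
  rw [lift_apply] at h
  exact h

/-! ## §2 The iterate along a backward planar trajectory -/

section Cascade

variable (P : CascadeParams)

/-- **The inviscid iterate is the datum transported along the backward planar trajectory**:
`a n (proj (z n)) = a 0 (proj (z 0))` whenever `z j = S_{H,j}(S_{V,j}(z (j+1)))` for `j < n`. [cite: BardosTitiWiedemann2012, Lemma 4] -/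
theorem iterate_proj_eq (hδ₀ : 0 < P.δ₀) (hd : 0 < P.d) (a b : ℕ → UnitAddTorus (Fin 2) → ℝ)
    (hb : ∀ j, b j = a j ∘ shearMap 0 1 (amp ⟨P.U j, P.U_periodic j, P.contDiff_U (P.δ_pos hδ₀ hd j)⟩ P.γ))
    (hab : ∀ j, a (j + 1) = b j ∘ shearMap 1 0 (amp ⟨P.U j, P.U_periodic j, P.contDiff_U (P.δ_pos hδ₀ hd j)⟩ P.γ))
    (n : ℕ) (z : ℕ → EuclideanSpace ℝ (Fin 2))
    (hz : ∀ j < n, z j = shearMapLift 0 1 (amp ⟨P.U j, P.U_periodic j, P.contDiff_U (P.δ_pos hδ₀ hd j)⟩ P.γ)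
      (shearMapLift 1 0 (amp ⟨P.U j, P.U_periodic j, P.contDiff_U (P.δ_pos hδ₀ hd j)⟩ P.γ) (z (j + 1)))) :
    a n (proj (z n)) = a 0 (proj (z 0)) := by
  induction n with
  | zero => rfl
  | succ n ih =>
    rw [← ih (fun j hj => hz j (hj.trans n.lt_succ_self)), hab n, Function.comp_apply, shearMap_proj, hb n,
      Function.comp_apply, shearMap_proj, ← hz n n.lt_succ_self]

/-- **With the cascade datum**: `a n (proj (z n)) = sin(2π (z 0)₀)` along a backward planar trajectory.
[cite: BardosTitiWiedemann2012, Lemma 4] -/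
theorem iterate_proj_eq_sin (hδ₀ : 0 < P.δ₀) (hd : 0 < P.d) (a b : ℕ → UnitAddTorus (Fin 2) → ℝ) (h0 : a 0 = datum)
    (hb : ∀ j, b j = a j ∘ shearMap 0 1 (amp ⟨P.U j, P.U_periodic j, P.contDiff_U (P.δ_pos hδ₀ hd j)⟩ P.γ))
    (hab : ∀ j, a (j + 1) = b j ∘ shearMap 1 0 (amp ⟨P.U j, P.U_periodic j, P.contDiff_U (P.δ_pos hδ₀ hd j)⟩ P.γ))
    (n : ℕ) (z : ℕ → EuclideanSpace ℝ (Fin 2))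
    (hz : ∀ j < n, z j = shearMapLift 0 1 (amp ⟨P.U j, P.U_periodic j, P.contDiff_U (P.δ_pos hδ₀ hd j)⟩ P.γ)
      (shearMapLift 1 0 (amp ⟨P.U j, P.U_periodic j, P.contDiff_U (P.δ_pos hδ₀ hd j)⟩ P.γ) (z (j + 1)))) :
    a n (proj (z n)) = Real.sin (2 * Real.pi * z 0 0) := by
  rw [iterate_proj_eq P hδ₀ hd a b hb hab n z hz, h0, datum_proj]

/-- **Coordinates of the backward trajectory** (the componentwise recursion of `…K1Start.norm_sub_sub_itinJac_mulVec_le`): with the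
V-output `w j = S_{V,j}(z (j+1))`: `w j 0 = z (j+1) 0`, `w j 1 = z (j+1) 1 − γ U_j (z (j+1) 0)`, `z j 0 = w j 0 − γ U_j (w j 1)`, `z j 1 = w j 1`.
[folklore] -/
theorem trajectory_coords (hδ₀ : 0 < P.δ₀) (hd : 0 < P.d) (n : ℕ) (z w : ℕ → EuclideanSpace ℝ (Fin 2))
    (hw : ∀ j < n, w j = shearMapLift 1 0 (amp ⟨P.U j, P.U_periodic j, P.contDiff_U (P.δ_pos hδ₀ hd j)⟩ P.γ) (z (j + 1)))
    (hz : ∀ j < n, z j = shearMapLift 0 1 (amp ⟨P.U j, P.U_periodic j, P.contDiff_U (P.δ_pos hδ₀ hd j)⟩ P.γ) (w j))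
    (j : ℕ) (hj : j < n) :
    w j 0 = z (j + 1) 0 ∧ w j 1 = z (j + 1) 1 - P.γ * P.U j (z (j + 1) 0) ∧
      z j 0 = w j 0 - P.γ * P.U j (w j 1) ∧ z j 1 = w j 1 := by
  have h1 := hw j hj
  have h2 := hz j hj
  refine ⟨?_, ?_, ?_, ?_⟩
  · rw [h1, shearMapLift_apply_coord]; simp
  · rw [h1, shearMapLift_apply_coord]; simp [amp_apply]
  · rw [h2, shearMapLift_apply_coord]; simp [amp_apply]
  · rw [h2, shearMapLift_apply_coord]; simp

end Cascade

end Summit.AnomalousDissipation.AnomalousDissipation.Theorems.SawtoothPulseCascade.K1Start
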